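import Literature.MathematicalPhysics.QuantumFieldTheory.Balaban1983to89.B12NodeKnitIndAPlug
import Literature.MathematicalPhysics.QuantumFieldTheory.Balaban1983to89.BlockAveragingExpMeanLogContinuous
import Literature.MathematicalPhysics.QuantumFieldTheory.Balaban1983to89.T4ReTrLipUnitary

/-!
# NODE N09 · [Balaban1987RG1] p. 254 ∕ p. 263 ∕ (2.16) p. 269 FOR CONTINUOUS TRANSPORTS — a CONTINUOUS renormalisation image of a
# lift-invariant density is gauge invariant EVERYWHERE, and N09's Theorem-3 member composition input `HCompT` over any transport family with
# the mapping property AT THE (0.19) DENSITIES MET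

T. Bałaban, *Renormalization group approach to lattice gauge field theories. I*, Commun. Math. Phys. **109** (1987) 249–301 [Balaban1987RG1]
(= [I]; PDF page = journal page − 248); [Balaban1985Variational] (= [B11], CMP 102) Thm 1 p. 279; [Balaban1985Averaging] (= [B7], CMP 98) (10) p. 19.
TRACK A (YM-PLAN §2b, node N09 of 28), seat `pub-ymgap-dag-n09-a` (prover, KNIT-BY-NAME; HUMAN RULING D-0062), generation g4.  THEOREMS ONLY, def-free,
sorry-free, standard axioms.  Successor of this seat's `B12EffectiveActionInvarianceT` (g3: gauge invariance of the effective actions `A_k` over a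
LIFT-COVARIANT transport family, `HCompT` from the [B11] inputs alone over such transports).

THE PRINT.  p. 254: *«(Tρ)(V) = ∫dU t(V,U)ρ(U). (0.13) […] t(V,U) is a gauge invariant kernel […]. If ρ is a gauge invariant function, then Tρ is
gauge invariant also.»*  p. 263: *«These assumptions imply that the action A_k(U) […] is gauge invariant with respect to all G-valued transformations.»*
p. 269: *«all the expressions in (2.12), together with the measure, are invariant with respect to the gauge transformations U_{k+1} → U^u_{k+1}, […]
(2.16) […] therefore the expression (2.13) is gauge invariant.»*  (`[…]` = omissions by the author of this file.)

WHY A SUCCESSOR.  In the tree every renormalisation transform of record is a CHOSEN VERSION of an a.e.-defined object — Stage 5's `Node00.TOfRecord`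
(`rnTransport`, a Radon–Nikodym derivative of the push-forward) and the Stage-9 tower's kernel transport (Mathlib's chosen marginal density and
disintegration kernel; node00-def-T [ERRATUM-VERSION] 2026-08-26) — so the p. 254 sentence holds for them only ALMOST EVERYWHERE
(`B12RTGaugeInvariance254.rtOpI_gaugeInvariant_ae`), while N09's Theorem-3 member reads the MIDDLE composition clauses of (0.23) as POINT VALUES
(`Node00.HCompT`): «unknowable at Stage 8∕9» ([DAGN09A-G3-MIDDLE-CLAUSES-NOTE]).  NODE 00's β re-point of record (director LINE №45 (2), RIDER №6 (b);
node00-def-T INTENT-4 `Node00/ContinuousTransportOfRecord.lean`, p423705) routes the actions through the CONTINUOUS-VERSION transport `TcOfRecord`: the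
continuous function in the a.e.-class of the transform, whenever there is one.  THIS FILE supplies the one fact that makes p. 254 a POINTWISE theorem for
such transports, and re-runs g3's chain with the mapping property asked only where the induction uses it:

* §1 (generic gauge group `G`, product topology `instTopologicalSpaceGaugeField` on `GaugeField P j G`):
  `continuous_gaugeAct` (bondwise `u(x)U(b)u(y)⁻¹` is continuous for a continuous multiplication); **`gaugeInvariant_of_ae_of_continuous`** — a CONTINUOUS
  function on `SU(N)^{bonds}`-type configuration spaces that is a.e.-invariant under each gauge transformation, for a measure charging every non-empty
  open set, is invariant EVERYWHERE (Mathlib `Continuous.ae_eq_iff_eq`); **`gaugeInvariant_of_isRT_of_continuous`** — p. 254 POINTWISE FOR CONTINUOUS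
  IMAGES: if `ρ'` is a renormalisation image (`Setup.IsRT`, the push-forward identity (10) of [B7]) of a LIFT-invariant `ρ` along a covariant averaging,
  integrable and continuous, then `ρ'(V^v) = ρ'(V)` for EVERY coarse field `V` and every coarse gauge transformation `v` (a.e. by the tree's
  `B12RTGaugeInvariance254.isRT_comp_gaugeAct` + `ae_eq_of_isRT`, everywhere by continuity); `gaugeInvariant_chiSmall` ∕ `liftInvariant_chiSmall` — the
  fixed-threshold plaquette characteristic functions `Setup.chiSmall S δ` ([I] p. 259 «|∂V − 1| < ε₀», the shape of NODE 00's `chiFixed7`) are gauge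
  invariant (`T4ReTrLipUnitary.plaqSmallOn_gaugeAct_iff`).
* §2 (`G = SU(N)`, node00-def-B's transport-family layer `Node00.BackgroundActionT`): `isOpenPosMeasure_fieldMeasure_SU` — product Haar measure on
  `SU(N)`-valued lattice gauge fields charges open sets (the tree's `fieldMeasure` ∕ `GaugeField` carrier; node00-def-T's `isOpenPosMeasure_piHaar_SUN` is the
  twin on the raw Pi carrier); `stepInvariant_of_isRT_continuous` — THE PER-STEP MAPPING PROPERTY «`T K j` sends the (0.19) density
  `χ_j·exp[−GF_j/g_j² + A_j]` (`B12Eq019ActionBody.integrand`) to a gauge-invariant function» from §1: it holds as soon as that image is an `IsRT` image,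
  integrable and continuous, and the density is lift-invariant; `gaugeInvariant_effActionHT_succ_of_step` (one step of (0.19) with body);
  **`gaugeInvariant_effActionHT_of_steps`** — p. 263 as a theorem of the body over ANY transport family with the mapping property asked ONLY AT THE (0.19)
  DENSITIES MET along the sequence (`∀ j < n, LiftInvariant (integrand_j) → GaugeInvariant (T K j integrand_j)`, `n ≤ m + K`): every `A_k`, `k ≤ n`, is gauge
  invariant (induction from `A_0 = −(1/g_0²)A^η`; lift-invariance of `χ_j` and of the pinned gauge fixing `gfOfRecord`); `liftInvariant_integrand_of_steps`
  (the densities met ARE lift-invariant — so §2's per-step property needs no invariance input); **`hInvT_of_steps`**, **`hCompT_of_steps`** (N09's composition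
  input `Node00.HCompT` from `HRestrict` + (1.1)-uniqueness at the intermediate levels + the per-step property — g3's `hCompT_of_liftCovariant` with the weaker
  hypothesis), **`indAOfRecordT_atRecord_of_steps`** (node00-def-B's (1.3)∕(0.23) at the record's own objects with the composition input DISCHARGED).
* §3 (the stage-free plug of `B12NodeKnitIndAPlug`): **`thm3Member_of_indATPlug_of_steps`**, `b12_main_of_indATPlug_of_leaf_of_steps` — for a binding world whose
  run flow is `genFlow β P.g₀` and whose `IndAss k` IS `IndAOfRecordT T' χ ε β …` at the record's objects, the Theorem-3 member `smallCouplings →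
  smallFieldInductive` (hence N09 given its own leaf) from (1.1) on the domains, `HRestrict`, intermediate uniqueness, χ-locality, lift-invariant `χ`, and the
  per-step property — over a continuous-version transport the last is §2's `stepInvariant_of_isRT_continuous`, i.e. an `IsRT` + continuity proviso per step.

WHAT THIS BUYS N09 (census `B12NodeKnitRecord8` §4∕§6, `B12NodeKnitRecord9`): at a NODE 00 record whose `IndAss` slot reads the actions through a transport
whose images of the (0.19) densities are continuous `IsRT` images (node00-def-T's `TcOfRecord` under its displayed proviso `HasContTransportAlong`), the middle
composition clauses of (0.23) are THEOREMS, and N09's Theorem-3 member consumes [B11] Thm 1 at the record's objects ((1.1), `HRestrict`, intermediate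
uniqueness), the flow recursion, and NODE 00's continuity∕integrability provisos — nothing else of the in-edges; the instantiation at `TcOfRecord` with
def-χ's `chiFixed7` is the sibling module `B12NodeKnitContinuousTransport` (after p423705 lands).
HONEST FRAMING: count-neutral kernel bookkeeping + one folklore upgrade (a.e. ⇒ everywhere for continuous functions on an open-positive measure); the
EXISTENCE of continuous versions, the `IsRT`∕integrability of the images and the [B11] inputs are HYPOTHESES (located: p. 254, (2.16) p. 269, [B11] Thm 1
p. 279; NODE 00's provisos); nothing of Bałaban's asserted beyond the cited algebra; no estimate; N09 NOT discharged; conjunct 1 (the B12-group pin)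
untouched; one finite four-torus programme at fixed ε per run — NOT ℝ⁴, NOT infinite volume, NOT OS axioms, NOT a mass gap, NOT the Clay problem.
-/

noncomputable section

namespace Literature.MathematicalPhysics.QuantumFieldTheory.Balaban1983to89.B12ContinuousTransportInvariance

open MeasureTheory
open DagBinding Node00 T4Continuum
open FlowStep (HBeta prefixOf RGEqH)
open FlowStepRuns (genSeq genFlow)
open T4FlagMemory (extd)
open B12Eq019ActionBody (integrand nextAction_apply)
open B12RTGaugeInvariance254 (LiftInvariant liftInvariant_of_gaugeInvariant liftInvariant_sfDensity isRT_comp_gaugeAct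
  ae_eq_of_isRT integrable_comp_gaugeAct)
open GaugeField (GaugeInvariant gaugeAct)
open B12EffectiveActionInvarianceT (gfOfRecord_liftInvariant hInvT_of_gaugeInvariant)
open B12NodeKnitRecord8 (b12_main_of_leaf_of_thm3Member)
open B12NodeKnitIndAPlug (thm3Member_of_indATPlug_of_hCompT)

/-! ## §1. Generic gauge group: continuous a.e.-invariant functions are invariant; p. 254 pointwise for continuous images -/

section Generic

variable {P : Params} {j : ℕ} {G : Type*} [GaugeGroup G] [TopologicalSpace G]

/-- A gauge transformation `U ↦ U^u`, `U^u(x,y) = u(x)U(x,y)u(y)⁻¹`, acts CONTINUOUSLY on configurations (product topology; bondwise left and right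
multiplication by constants). [cite: Balaban1985Averaging, (8) p.19] -/
theorem continuous_gaugeAct [ContinuousMul G] (u : GaugeTransf P j G) : Continuous (gaugeAct u : GaugeField P j G → GaugeField P j G) := by
  refine continuous_pi fun b => ?_
  show Continuous fun U : GaugeField P j G => u b.src * U b * (u b.tgt)⁻¹
  exact (continuous_const.mul (show Continuous fun U : GaugeField P j G => U b from continuous_apply b)).mul continuous_const

variable [MeasurableSpace G] [HaarData G]

/-- **A.E.-INVARIANT + CONTINUOUS ⇒ INVARIANT.**  If `ρ` is continuous on `GaugeField P j G` (product topology), each gauge transformation acts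
continuously, the product Haar measure `dU` charges every non-empty open set, and `ρ(U^u) = ρ(U)` for `dU`-a.e. `U` for each `u`, then `ρ(U^u) = ρ(U)` for
EVERY `U` — two continuous functions agreeing a.e. on an open-positive measure agree everywhere (Mathlib `Continuous.ae_eq_iff_eq`).  The upgrade the
p. 254 sentence needs over a continuous-version transport. [cite: Balaban1987RG1, (0.13) p.254] -/
theorem gaugeInvariant_of_ae_of_continuous [(fieldMeasure P j G).IsOpenPosMeasure]
    (hact : ∀ u : GaugeTransf P j G, Continuous (gaugeAct u : GaugeField P j G → GaugeField P j G))
    {ρ : Density P j G} (hc : Continuous ρ) (hae : ∀ u : GaugeTransf P j G, (fun U => ρ (gaugeAct u U)) =ᵐ[fieldMeasure P j G] ρ) :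
    GaugeInvariant ρ := fun u U =>
  congrFun ((Continuous.ae_eq_iff_eq (fieldMeasure P j G) (hc.comp (hact u)) hc).1 (hae u)) U

variable [MeasurableMul₂ G]

/-- **p. 254 «If ρ is a gauge invariant function, then Tρ is gauge invariant also» — POINTWISE FOR CONTINUOUS IMAGES.**  In the standing range
`j + 1 ≤ m + K`, for a covariant averaging `av`: if `ρ'` is a renormalisation image of `ρ` (`Setup.IsRT av.avg ρ ρ'`, [B7] (10) in the push-forward
reading), `ρ` is invariant under the block-constant lifts of the coarse gauge transformations (`LiftInvariant`, e.g. gauge invariant), `ρ'` is integrable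
and CONTINUOUS, the coarse product Haar measure charges open sets and the coarse gauge group acts continuously, then `ρ'(V^v) = ρ'(V)` for EVERY coarse
field `V`: a.e. by `isRT_comp_gaugeAct` («`V ↦ ρ'(V^v)` is an image of `ρ` too», p. 265's covariance sentence) + `ae_eq_of_isRT` (uniqueness a.e. of
integrable images), everywhere by `gaugeInvariant_of_ae_of_continuous`. [cite: Balaban1987RG1, (0.13) p.254 and (2.1) p.265] -/
theorem gaugeInvariant_of_isRT_of_continuous [(fieldMeasure P (j+1) G).IsOpenPosMeasure]
    (hact : ∀ v : GaugeTransf P (j+1) G, Continuous (gaugeAct v : GaugeField P (j+1) G → GaugeField P (j+1) G))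
    (hj : j + 1 ≤ P.m + P.K) (av : Averaging P j G) {ρ : Density P j G} {ρ' : Density P (j+1) G} (h : IsRT av.avg ρ ρ')
    (hρ : LiftInvariant ρ) (hi : Integrable ρ' (fieldMeasure P (j+1) G)) (hc : Continuous ρ') : GaugeInvariant ρ' :=
  gaugeInvariant_of_ae_of_continuous hact hc fun v =>
    ae_eq_of_isRT (isRT_comp_gaugeAct hj av h hρ v) h (integrable_comp_gaugeAct hi v) hi

omit [TopologicalSpace G] [MeasurableSpace G] [HaarData G] [MeasurableMul₂ G] in
/-- **THE FIXED-THRESHOLD PLAQUETTE CHARACTERISTIC FUNCTIONS ARE GAUGE INVARIANT**: `χ({|U(∂p) − 1| < δ, p ∈ S})` (`Setup.chiSmall`; [I] p. 259 «|∂V − 1| < ε₀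
on T₁^{(k)}», the shape of NODE 00's `chiFixAltOfRecord` ∕ `chiFixed7`) takes the same value at `U^u` and `U` — plaquette variables are conjugated and
`dist1` is conjugation invariant (`T4ReTrLipUnitary.plaqSmallOn_gaugeAct_iff`). [cite: Balaban1987RG1, p.259 and (0.16) p.255] -/
theorem gaugeInvariant_chiSmall (S : Set (Plaq P j)) (δ : ℝ) : GaugeInvariant (chiSmall S δ : Density P j G) := by
  intro u U
  unfold chiSmall
  by_cases h : PlaqSmallOn S δ U
  · rw [if_pos h, if_pos ((T4ReTrLipUnitary.plaqSmallOn_gaugeAct_iff S δ u U).2 h)]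
  · rw [if_neg h, if_neg (mt (T4ReTrLipUnitary.plaqSmallOn_gaugeAct_iff S δ u U).1 h)]

omit [TopologicalSpace G] [MeasurableSpace G] [HaarData G] [MeasurableMul₂ G] in
/-- … hence lift-invariant (the form the (0.19) induction consumes). [cite: Balaban1987RG1, p.259 and (0.16) p.255] -/
theorem liftInvariant_chiSmall (S : Set (Plaq P j)) (δ : ℝ) : LiftInvariant (chiSmall S δ : Density P j G) :=
  liftInvariant_of_gaugeInvariant (gaugeInvariant_chiSmall S δ)

end Generic

/-! ## §2. `G = SU(N)`: the per-step mapping property from §1, and p. 263 over a transport with that property at the densities met -/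

variable (F : T4Family) (N : ℕ) [NeZero N]

/-- Product Haar measure on `SU(N)`-valued gauge fields of `T^{(j)}` CHARGES EVERY NON-EMPTY OPEN SET (normalised Haar measure on the compact group `SU(N)`
does — it is Mathlib's `haarMeasure`; finite products preserve the property).  Stated on the tree's carrier `fieldMeasure P j (SU N)` ∕ `GaugeField` with its
product topology `instTopologicalSpaceGaugeField`. [cite: Balaban1985Averaging, (10) p.19 (bookkeeping)] -/
theorem isOpenPosMeasure_fieldMeasure_SU (P : Params) (j : ℕ) : (fieldMeasure P j (SU N)).IsOpenPosMeasure := by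
  haveI : (HaarData.haar : Measure (SU N)).IsOpenPosMeasure := by
    show (haarProbability (SU N)).IsOpenPosMeasure
    unfold haarProbability; infer_instance
  show (Measure.pi fun _ : PBond P j => (HaarData.haar : Measure (SU N))).IsOpenPosMeasure
  infer_instance

/-- The gauge group of `T^{(j)}` acts continuously on `SU(N)`-valued configurations (§1 at the topological group `SU(N)`). [cite: Balaban1985Averaging, (8) p.19] -/
theorem continuous_gaugeAct_SU (P : Params) (j : ℕ) (u : GaugeTransf P j (SU N)) :
    Continuous (gaugeAct u : GaugeField P j (SU N) → GaugeField P j (SU N)) :=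
  continuous_gaugeAct u

variable {F N}

/-- **THE PER-STEP MAPPING PROPERTY FROM §1** (transport family `T`, torus `K`, step `j + 1 ≤ m + K`): if the image under `T K j` of the (0.19) density
`ρ_j := χ_j·exp[−GF_j/g_j² + A_j]` met at step `j` is a renormalisation image of it along the averaging of record (`IsRT`), integrable and CONTINUOUS, then
lift-invariance of `ρ_j` gives gauge invariance of `T K j ρ_j` at EVERY coarse field (`gaugeInvariant_of_isRT_of_continuous` at `SU(N)`).  Over node00-def-T's
continuous-version transport the three inputs are `isRT_TcOfRecord` (under its displayed `HasContTransportAt`), integrability of a continuous function on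
the compact `SU(N)^{bonds}`, and `continuous_TcOfRecord`. [cite: Balaban1987RG1, (0.13) p.254 and (0.19) p.255] -/
theorem stepInvariant_of_isRT_continuous (T : Transport F N) (χ : (K : ℕ) → (ℕ → ℝ) → (k : ℕ) → Density (F.P K) k (SU N)) (K : ℕ) (g : ℕ → ℝ)
    {j : ℕ} (hj : j + 1 ≤ (F.P K).m + (F.P K).K)
    (hRT : IsRT (avOfRecord F N K j).avg (integrand (χ K g j) (gfOfRecord F N K j) (g j) (effActionHT F N T χ K g j))
      (T K j (integrand (χ K g j) (gfOfRecord F N K j) (g j) (effActionHT F N T χ K g j))))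
    (hint : Integrable (T K j (integrand (χ K g j) (gfOfRecord F N K j) (g j) (effActionHT F N T χ K g j))) (fieldMeasure (F.P K) (j + 1) (SU N)))
    (hcont : Continuous (T K j (integrand (χ K g j) (gfOfRecord F N K j) (g j) (effActionHT F N T χ K g j)))) :
    LiftInvariant (integrand (χ K g j) (gfOfRecord F N K j) (g j) (effActionHT F N T χ K g j)) →
      GaugeInvariant (T K j (integrand (χ K g j) (gfOfRecord F N K j) (g j) (effActionHT F N T χ K g j))) := fun hρ =>
  haveI := isOpenPosMeasure_fieldMeasure_SU N (F.P K) (j + 1)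
  gaugeInvariant_of_isRT_of_continuous (continuous_gaugeAct_SU N (F.P K) (j + 1)) hj (avOfRecord F N K j) hRT hρ hint hcont

/-- **ONE STEP OF (0.19) WITH BODY**: if `T K j` sends the density met at step `j` to a gauge-invariant function, then `A_{j+1} = log 𝐍_j⁻¹ (T K j ρ_j)(·)` is
gauge invariant (`𝐍_j` does not see the argument). [cite: Balaban1987RG1, (0.19) p.255] -/
theorem gaugeInvariant_effActionHT_succ_of_step (T : Transport F N) (χ : (K : ℕ) → (ℕ → ℝ) → (k : ℕ) → Density (F.P K) k (SU N)) (K : ℕ)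
    (g : ℕ → ℝ) (j : ℕ) (hTj : GaugeInvariant (T K j (integrand (χ K g j) (gfOfRecord F N K j) (g j) (effActionHT F N T χ K g j)))) :
    GaugeInvariant (effActionHT F N T χ K g (j + 1)) := by
  intro v V
  rw [effActionHT_succ, nextAction_apply, nextAction_apply, hTj v V]

/-- The (0.19) density met at step `j` is lift-invariant as soon as `χ_j` is and `A_j` is gauge invariant (`gfOfRecord` is lift-invariant by
`B12EffectiveActionInvarianceT.gfOfRecord_liftInvariant`; `liftInvariant_sfDensity`). [cite: Balaban1987RG1, (0.17) p.255 and (0.19) p.255] -/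
theorem liftInvariant_integrand_of_gaugeInvariant (T : Transport F N) (χ : (K : ℕ) → (ℕ → ℝ) → (k : ℕ) → Density (F.P K) k (SU N)) (K : ℕ)
    (g : ℕ → ℝ) {j : ℕ} (hj : j + 1 ≤ (F.P K).m + (F.P K).K) (hχ : LiftInvariant (χ K g j)) (hA : GaugeInvariant (effActionHT F N T χ K g j)) :
    LiftInvariant (integrand (χ K g j) (gfOfRecord F N K j) (g j) (effActionHT F N T χ K g j)) :=
  liftInvariant_sfDensity hχ (gfOfRecord_liftInvariant F N K hj) (liftInvariant_of_gaugeInvariant hA) (g j)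

/-- **THE EFFECTIVE ACTIONS ARE GAUGE INVARIANT (p. 263) over a transport with the mapping property AT THE DENSITIES MET**: for `n ≤ m + K`, if for every
`j < n` the image `T K j ρ_j` of the (0.19) density met at step `j` is gauge invariant WHENEVER `ρ_j` is lift-invariant, and `χ_j` is lift-invariant for
`j < n`, then every `A_k = effActionHT F N T χ K g k` with `k ≤ n` is gauge invariant — induction on `k` from `A_0 = −(1/g_0²)A^η`
(`T4WilsonGaugeFlatDirection.gaugeInvariant_wilsonExponent`), the step `gaugeInvariant_effActionHT_succ_of_step`, and `liftInvariant_integrand_of_gaugeInvariant`.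
(g3's `B12EffectiveActionInvarianceT.gaugeInvariant_effActionHT` asks the mapping property at ALL lift-invariant densities; a version-defined transport has
it only where continuous versions exist — hence this form.) [cite: Balaban1987RG1, p.263 («the action A_k(U) … is gauge invariant»), (0.13) p.254 and (0.19) p.255] -/
theorem gaugeInvariant_effActionHT_of_steps (T : Transport F N) (χ : (K : ℕ) → (ℕ → ℝ) → (k : ℕ) → Density (F.P K) k (SU N)) (K : ℕ)
    (g : ℕ → ℝ) {n : ℕ} (hn : n ≤ (F.P K).m + (F.P K).K) (hχ : ∀ j < n, LiftInvariant (χ K g j))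
    (hstep : ∀ j < n, LiftInvariant (integrand (χ K g j) (gfOfRecord F N K j) (g j) (effActionHT F N T χ K g j)) →
      GaugeInvariant (T K j (integrand (χ K g j) (gfOfRecord F N K j) (g j) (effActionHT F N T χ K g j)))) :
    ∀ k ≤ n, GaugeInvariant (effActionHT F N T χ K g k) := by
  intro k
  induction k with
  | zero =>
    intro _
    rw [effActionHT_zero]
    exact T4WilsonGaugeFlatDirection.gaugeInvariant_wilsonExponent _ _
  | succ k ih =>
    intro hk
    have hk' : k < n := Nat.lt_of_succ_le hk
    exact gaugeInvariant_effActionHT_succ_of_step T χ K g k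
      (hstep k hk' (liftInvariant_integrand_of_gaugeInvariant T χ K g ((Nat.succ_le_of_lt hk').trans hn) (hχ k hk') (ih hk'.le)))

/-- Under the same hypotheses EVERY (0.19) density met at a step `j < n` IS lift-invariant — so the per-step property is only ever invoked at lift-invariant
densities, and §2's `stepInvariant_of_isRT_continuous` needs no invariance input of its own. [cite: Balaban1987RG1, (0.19) p.255 and p.263] -/
theorem liftInvariant_integrand_of_steps (T : Transport F N) (χ : (K : ℕ) → (ℕ → ℝ) → (k : ℕ) → Density (F.P K) k (SU N)) (K : ℕ)
    (g : ℕ → ℝ) {n : ℕ} (hn : n ≤ (F.P K).m + (F.P K).K) (hχ : ∀ j < n, LiftInvariant (χ K g j))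
    (hstep : ∀ j < n, LiftInvariant (integrand (χ K g j) (gfOfRecord F N K j) (g j) (effActionHT F N T χ K g j)) →
      GaugeInvariant (T K j (integrand (χ K g j) (gfOfRecord F N K j) (g j) (effActionHT F N T χ K g j)))) :
    ∀ j < n, LiftInvariant (integrand (χ K g j) (gfOfRecord F N K j) (g j) (effActionHT F N T χ K g j)) := fun j hj =>
  liftInvariant_integrand_of_gaugeInvariant T χ K g ((Nat.succ_le_of_lt hj).trans hn) (hχ j hj)
    (gaugeInvariant_effActionHT_of_steps T χ K g hn hχ hstep j hj.le)

/-- **`HInvT` AT LEVEL `k ≤ n`** (the residual-gauge invariance of `A_j ∘ Ū^j`, `j < k` — [I] (0.21) ∕ (2.16)) over a transport with the per-step property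
below `n ≤ m + K` (g3's `hInvT_of_gaugeInvariant` on top of `gaugeInvariant_effActionHT_of_steps`). [cite: Balaban1987RG1, (0.21) p.256, p.263 and (2.16) p.269] -/
theorem hInvT_of_steps (T : Transport F N) (χ : (K : ℕ) → (ℕ → ℝ) → (k : ℕ) → Density (F.P K) k (SU N)) (K : ℕ) (g : ℕ → ℝ) {n : ℕ}
    (hn : n ≤ (F.P K).m + (F.P K).K) (hχ : ∀ j < n, LiftInvariant (χ K g j))
    (hstep : ∀ j < n, LiftInvariant (integrand (χ K g j) (gfOfRecord F N K j) (g j) (effActionHT F N T χ K g j)) →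
      GaugeInvariant (T K j (integrand (χ K g j) (gfOfRecord F N K j) (g j) (effActionHT F N T χ K g j))))
    {k : ℕ} (hk : k ≤ n) : HInvT F N T χ K g k :=
  hInvT_of_gaugeInvariant F N T χ K g (hk.trans hn) fun j hj =>
    gaugeInvariant_effActionHT_of_steps T χ K g hn hχ hstep j (hj.le.trans hk)

/-- **N09's COMPOSITION INPUT `HCompT` FROM THE [B11] INPUTS + THE PER-STEP PROPERTY** at every level `k ≤ n` of a run on the `K`-th torus (`n ≤ K`):
`HRestrict` ([B11] Thm 1 (8)–(10): the global minimiser restricts) + (1.1)-uniqueness at the intermediate levels ⇒ `HOrbit` (`Node00.hOrbit_of_hRestrict_of_unique`)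
⇒ with `hInvT_of_steps` ⇒ `HCompT` (`Node00.hCompT_of_hOrbit_of_hInvT`).  g3's `hCompT_of_liftCovariant` with the mapping property weakened to the densities met.
[cite: Balaban1987RG1, (0.21)–(0.23) p.256, (1.1) p.260 and (2.16) p.269; Balaban1985Variational, Thm 1 (8)–(10) p.279] -/
theorem hCompT_of_steps (T : Transport F N) (χ : (K : ℕ) → (ℕ → ℝ) → (k : ℕ) → Density (F.P K) k (SU N)) {ε : ℝ} (K : ℕ) (g : ℕ → ℝ)
    {n : ℕ} (hn : n ≤ K) (hχ : ∀ j < n, LiftInvariant (χ K g j))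
    (hstep : ∀ j < n, LiftInvariant (integrand (χ K g j) (gfOfRecord F N K j) (g j) (effActionHT F N T χ K g j)) →
      GaugeInvariant (T K j (integrand (χ K g j) (gfOfRecord F N K j) (g j) (effActionHT F N T χ K g j))))
    {k : ℕ} (hk : k ≤ n) {dom : Set (GaugeField (F.P K) k (SU N))} (hres : HRestrict F N ε K k dom)
    (huniq : ∀ V ∈ dom, ∀ j < k, UniqueUkOrbit F N K (j + 1) ε (Averaging.iter (avOfRecord F N K) (j + 1) (Uk F N K k ε V))) :
    HCompT F N T χ ε K g k dom :=
  hCompT_of_hOrbit_of_hInvT F N T χ (hOrbit_of_hRestrict_of_unique F N hres huniq)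
    (hInvT_of_steps T χ K g (hn.trans (Nat.le_add_left _ _)) hχ hstep hk)

/-- **(1.3)∕(0.23) AT THE RECORD, COMPOSITION INPUT DISCHARGED, over a transport with the per-step property** at the levels `< k` of run `p` (`k ≤ K`):
node00-def-B's `Node00.indAOfRecordT_atRecord` with `hcomp := hCompT_of_steps` — the format clause `IndAOfRecordT T …` at the record's own history, domain,
action, background action and expansion term follows from χ-locality, the flow recursion (0.20) up to `k`, [B11] Thm 1 at the record's objects ((1.1) on the
domain, `HRestrict`, intermediate uniqueness), lift-invariant `χ_j` and the per-step property for `j < k`. [cite: Balaban1987RG1, (1.1)–(1.3) p.260, (0.22)–(0.23) p.256, p.263 and (2.16) p.269] -/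
theorem indAOfRecordT_atRecord_of_steps (T : Transport F N) (χ : (K : ℕ) → (ℕ → ℝ) → (k : ℕ) → Density (F.P K) k (SU N)) (ε : ℝ) (β : HBeta)
    (p : B12.RunParams) (k : ℕ) (hk : k ≤ p.K) (dom : Set (GaugeField (F.P p.K) k (SU N)))
    (hχinv : ∀ j < k, LiftInvariant (χ p.K (genSeq β p.g0) j))
    (hstep : ∀ j < k, LiftInvariant (integrand (χ p.K (genSeq β p.g0) j) (gfOfRecord F N p.K j) (genSeq β p.g0 j)
        (effActionHT F N T χ p.K (genSeq β p.g0) j)) →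
      GaugeInvariant (T p.K j (integrand (χ p.K (genSeq β p.g0) j) (gfOfRecord F N p.K j) (genSeq β p.g0 j)
        (effActionHT F N T χ p.K (genSeq β p.g0) j))))
    (hχ : ∀ n ≤ k, χ p.K (extd (prefixOf (genSeq β p.g0) k)) n = χ p.K (genSeq β p.g0) n)
    (hflow : RGEqH k β (genSeq β p.g0))
    (h11 : ∀ V ∈ dom, UkExists F N p.K k ε V ∧ UniqueUkOrbit F N p.K k ε V)
    (hres : HRestrict F N ε p.K k dom)
    (huniq : ∀ V ∈ dom, ∀ j < k, UniqueUkOrbit F N p.K (j + 1) ε (Averaging.iter (avOfRecord F N p.K) (j + 1) (Uk F N p.K k ε V))) :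
    IndAOfRecordT F N T χ ε β p k (prefixOf (genSeq β p.g0) k) dom
      (effActionOfRecordT F N T χ β p k) (wilsonBGOfRecord F N ε p k) (EkOfRecordT F N T χ ε β p k) :=
  indAOfRecordT_atRecord F N T χ ε β p k dom hχ hflow h11 (hCompT_of_steps T χ p.K (genSeq β p.g0) hk hχinv hstep le_rfl hres huniq)

/-! ## §3. The Theorem-3 member through the stage-free plug over such a transport -/

section Plug

variable {w : WorldP} {P : B12.RunParams} (T' : Transport F N) (χ : (K : ℕ) → (ℕ → ℝ) → (k : ℕ) → Density (F.P K) k (SU N)) (ε : ℝ)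
  (β : HBeta) (dom : (k : ℕ) → Set (GaugeField (F.P P.K) k (SU N)))
  (hflow : (w.C P).flow = genFlow β P.g0)
  (hind : ∀ k, k ≤ P.K → ((w.C P).IndAss k ↔
    IndAOfRecordT F N T' χ ε β P k (prefixOf (genSeq β P.g0) k) (dom k) (effActionOfRecordT F N T' χ β P k) (wilsonBGOfRecord F N ε P k)
      (EkOfRecordT F N T' χ ε β P k)))
  (hχ : ∀ k, k ≤ P.K → ∀ n ≤ k, χ P.K (extd (prefixOf (genSeq β P.g0) k)) n = χ P.K (genSeq β P.g0) n)

include hflow hind hχ in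
/-- **THE MEMBER OVER A TRANSPORT WITH THE PER-STEP PROPERTY, FROM [B11] THM 1 ALONE**: for a binding world whose run flow is `genFlow β P.g₀` and whose
`IndAss k` IS node00-def-B's `IndAOfRecordT T' χ ε β …` at the record's own objects, if for every step `j < K` the image under `T' K j` of the (0.19) density met
is gauge invariant whenever that density is lift-invariant (over a continuous-version transport: §2's `stepInvariant_of_isRT_continuous`), and the
characteristic functions along the run are lift-invariant, then `smallCouplings → smallFieldInductive` follows from (1.1) on the domains, `HRestrict` and
(1.1)-uniqueness at the intermediate levels — [B11] Thm 1 at the record's objects, N07's content — via `B12NodeKnitIndAPlug.thm3Member_of_indATPlug_of_hCompT` and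
`hCompT_of_steps`. [cite: Balaban1987RG1, Thm 3 p.264, (0.13) p.254, p.263 and (2.16) p.269; Balaban1985Variational, Thm 1 p.279] -/
theorem thm3Member_of_indATPlug_of_steps
    (hχinv : ∀ j < P.K, LiftInvariant (χ P.K (genSeq β P.g0) j))
    (hstep : ∀ j < P.K, LiftInvariant (integrand (χ P.K (genSeq β P.g0) j) (gfOfRecord F N P.K j) (genSeq β P.g0 j)
        (effActionHT F N T' χ P.K (genSeq β P.g0) j)) →
      GaugeInvariant (T' P.K j (integrand (χ P.K (genSeq β P.g0) j) (gfOfRecord F N P.K j) (genSeq β P.g0 j)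
        (effActionHT F N T' χ P.K (genSeq β P.g0) j))))
    (h11 : ∀ k, k ≤ P.K → ∀ V ∈ dom k, UkExists F N P.K k ε V ∧ UniqueUkOrbit F N P.K k ε V)
    (hres : ∀ k, k ≤ P.K → HRestrict F N ε P.K k (dom k))
    (huniq : ∀ k, k ≤ P.K → ∀ V ∈ dom k, ∀ j < k,
      UniqueUkOrbit F N P.K (j + 1) ε (Averaging.iter (avOfRecord F N P.K) (j + 1) (Uk F N P.K k ε V))) :
    (leavesP w P).smallCouplings → (leavesP w P).smallFieldInductive :=
  thm3Member_of_indATPlug_of_hCompT T' χ ε β dom hflow hind hχ h11 fun k hk =>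
    hCompT_of_steps T' χ P.K (genSeq β P.g0) le_rfl hχinv hstep hk (hres k hk) (huniq k hk)

include hflow hind hχ in
/-- **N09 AT `(w, P)` OVER SUCH A TRANSPORT**: its own leaf `b12` + the inputs of `thm3Member_of_indATPlug_of_steps` ⇒ `Dag.B12_main (leavesP w P)`
(`B12NodeKnitRecord8.b12_main_of_leaf_of_thm3Member`; the other in-edges are not consumed). [cite: Balaban1987RG1, Lemma 4 (3.53) p.280, Thm 3 p.264 and (1.1)–(1.3) p.260] -/
theorem b12_main_of_indATPlug_of_leaf_of_steps (h12 : (leavesP w P).b12)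
    (hχinv : ∀ j < P.K, LiftInvariant (χ P.K (genSeq β P.g0) j))
    (hstep : ∀ j < P.K, LiftInvariant (integrand (χ P.K (genSeq β P.g0) j) (gfOfRecord F N P.K j) (genSeq β P.g0 j)
        (effActionHT F N T' χ P.K (genSeq β P.g0) j)) →
      GaugeInvariant (T' P.K j (integrand (χ P.K (genSeq β P.g0) j) (gfOfRecord F N P.K j) (genSeq β P.g0 j)
        (effActionHT F N T' χ P.K (genSeq β P.g0) j))))
    (h11 : ∀ k, k ≤ P.K → ∀ V ∈ dom k, UkExists F N P.K k ε V ∧ UniqueUkOrbit F N P.K k ε V)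
    (hres : ∀ k, k ≤ P.K → HRestrict F N ε P.K k (dom k))
    (huniq : ∀ k, k ≤ P.K → ∀ V ∈ dom k, ∀ j < k,
      UniqueUkOrbit F N P.K (j + 1) ε (Averaging.iter (avOfRecord F N P.K) (j + 1) (Uk F N P.K k ε V))) :
    Dag.B12_main (leavesP w P) :=
  b12_main_of_leaf_of_thm3Member h12 (thm3Member_of_indATPlug_of_steps T' χ ε β dom hflow hind hχ hχinv hstep h11 hres huniq)

end Plug

end Literature.MathematicalPhysics.QuantumFieldTheory.Balaban1983to89.B12ContinuousTransportInvariance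

end
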